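import Summits.CriticalPhenomena.PercolationContinuityZ3.Theorems.Transplant.SkelFrmBParamsFaceCountsShiftA
import Summits.CriticalPhenomena.PercolationContinuityZ3.Theorems.Transplant.SkelFrmBParamsFaceFloorsClrXA
import Summits.CriticalPhenomena.PercolationContinuityZ3.Theorems.Transplant.SkelFrmBParamsFaceTop
import Summits.CriticalPhenomena.PercolationContinuityZ3.Theorems.Transplant.SkelPhiFaceNumsCross
import Summits.CriticalPhenomena.PercolationContinuityZ3.Theorems.Transplant.PlanarSkeletonFrmDefs
import Summits.CriticalPhenomena.PercolationContinuityZ3.Theorems.Transplant.SkelPhiStepIDataNS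
import HarnessLib
/-!
(F) VALUE LAYER, N2 twin (hp-8 g42, 2026-08-23; F-DISCHARGE-MAP-N2 G18): `port_frm.py` text of N1 `SkelNegBParamsFaceCountsShiftYA` (hp-8 g36) over
`…FaceCountsShiftA` / `…FaceFloorsClrXA` / `…FaceTop` (N2) — the y′ cross-shift reading bounds `Λ₁of_crossOffY`, `Λ₀of_crossOffY`, `sLoU_bounds`, `u₁_mul_U_le`,
`F1cA_crossOffY_sub_abs_le`, `FcA_crossOffY_sub_abs_le` (cell-free readings; verbatim), `units_eqA` projections re-indexed.
NON-VACUITY: arithmetic under `EqNumL` and `|h_L| ≤ 10 n_L`.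
builds on p205010 (kernel theorem, internal audit signed; external expert review pending); nothing here is a claim about the open node `SamePDropOfSkeletonFrm₁`.
N1 HEADER (kept for the reader):
# N1 params, M3′ part 1b′ — **THE y′-RUN'S CROSS OFFSET MOVES THE READINGS BY A CONTROLLED AMOUNT**: for the tangential origin
# `yT := yL + Skelφ.crossOffY n_L ℓ_L h_L v_L σ N_r` of a y′-face (σ = ±1, `N_r + 1` regions of nominal level advance `U·s_lo`,
# `s_lo = ⌊(n_Lℓ_L − U + 1)/U⌋`, `0 ≤ m − U·s_lo ≤ 2U − 2`):
# **`|F1cA yT − F1cA yL − σ·u₁·(N_r+1)| ≤ 2(N_r+1) + 2`** (the ordinate reading advances by `u₁` per region up to the floor deficit) and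
# **`|FcA yT − FcA yL| ≤ u₀`** (the abscissa reading drifts by `σ(N_r+1)·v_L·(m − U s_lo)/n_L` in `Λ₀`, i.e. `≤ (N_r+1)(2U−2) + n_L`, which is below
# `(u₀−1)·m/u₀` once `25(N_r+1) + 13 ≤ ℓ_L` and `11 ≤ u₀`).  These are the position facts the y′-face last-core floors `KS.FL?_YA_gen` (hp-8, FloorsLYA)
# and the tangential x-run floors consume together with the nominal counts `KS.NrY_spec/N3Y_spec` (CountsYA).  Twin in rôle of p3-g12's ShiftA
# (`FcA_yTX0_sub_abs_le`, `F1cA_yTX0_sub_abs_le`), whose `ediv_sub_ediv_abs_le`, `u₀_mul_L0hat_le` are reused.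
builds on p205010 (kernel theorem, internal audit signed; external expert review pending) — nothing in this file uses p205010; NOTHING is claimed about the node
`SamePDropOfSkeletonNeg₁` (OPEN); integer arithmetic only.
Lane `prim-bschramm`, seat `prim-hp-8` (gen 36); helper file (`--supports stmt-CriticalPhenomena-4575 --as helper`); slot-ledger ζ′ v1/v2.
* `Λ₁of_crossOffY`, `Λ₀of_crossOffY`, `sLoU_bounds`, `u₁_mul_U_le`, **`F1cA_crossOffY_sub_abs_le`**, **`FcA_crossOffY_sub_abs_le`**.
[cite: KozmaNitzan2024, §4 Lemma 11 (p. 22), Lemma 12 (pp. 23–25)] [cite: MartineauTassion2017, §4.1]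
-/

noncomputable section

open scoped Classical

namespace Summit.CriticalPhenomena.PercolationContinuityZ3.Theorems.Transplant

namespace PlanarSkeletonFrm

namespace NegB

open Literature.Probability.Percolation Literature.Probability.LatticeModels SimpleGraph
open SkelConc (Consts)
open Skelφ (shearUnit)
open Skelφ.StepI (DataN)
open TwoAxis.Para (modulus)
open Neg

namespace KS

section ShiftY

/-- The y′-run's cross offset moves `Λ₁` by `n_L·Y − h_L·X` (`(X, Y)` the offset's components). [folklore] -/
theorem Λ₁of_crossOffY (κ : Consts) {V : Type} [DecidableEq V] [Countable V] {G : SimpleGraph V} [G.LocallyFinite] (Φ : PlanarSkeletonFrm G) (t : V) (p : unitInterval) (D : Skelφ.StepI.DataNS V) (g : ℕ) (f : ℕ) (yL : Site 2) (σ : ℤ) (Nr : ℕ) :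
    Λ₁of κ Φ t p D g f (yL + (Skelφ.crossOffY (nL κ Φ t p D g f) (ℓL κ Φ t p D g f) (hL κ Φ t p D g f) (vL κ Φ t p D g f) σ Nr)) - Λ₁of κ Φ t p D g f yL = ((nL κ Φ t p D g f) : ℤ) * (Skelφ.crossOffY (nL κ Φ t p D g f) (ℓL κ Φ t p D g f) (hL κ Φ t p D g f) (vL κ Φ t p D g f) σ Nr) 1 - (hL κ Φ t p D g f) * (Skelφ.crossOffY (nL κ Φ t p D g f) (ℓL κ Φ t p D g f) (hL κ Φ t p D g f) (vL κ Φ t p D g f) σ Nr) 0 := by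
  unfold Λ₁of; simp only [Pi.add_apply]; ring

/-- The y′-run's cross offset moves `Λ₀` by `v_β·X − v_L·Y`. [folklore] -/
theorem Λ₀of_crossOffY (κ : Consts) {V : Type} [DecidableEq V] [Countable V] {G : SimpleGraph V} [G.LocallyFinite] (Φ : PlanarSkeletonFrm G) (t : V) (p : unitInterval) (D : Skelφ.StepI.DataNS V) (g : ℕ) (f : ℕ) (yL : Site 2) (σ : ℤ) (Nr : ℕ) :
    Λ₀of κ Φ t p D g f (yL + (Skelφ.crossOffY (nL κ Φ t p D g f) (ℓL κ Φ t p D g f) (hL κ Φ t p D g f) (vL κ Φ t p D g f) σ Nr)) - Λ₀of κ Φ t p D g f yL = (vβL κ Φ t p D g f) * (Skelφ.crossOffY (nL κ Φ t p D g f) (ℓL κ Φ t p D g f) (hL κ Φ t p D g f) (vL κ Φ t p D g f) σ Nr) 0 - (vL κ Φ t p D g f) * (Skelφ.crossOffY (nL κ Φ t p D g f) (ℓL κ Φ t p D g f) (hL κ Φ t p D g f) (vL κ Φ t p D g f) σ Nr) 1 := by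
  unfold Λ₀of vβL; simp only [Pi.add_apply]; ring

/-- **The region level step against the modulus**: `0 ≤ m − U·s_lo ≤ 2U − 2` with `s_lo = ⌊(n_Lℓ_L − U + 1)/U⌋`. [folklore] -/
theorem sLoU_bounds (κ : Consts) {V : Type} [DecidableEq V] [Countable V] {G : SimpleGraph V} [G.LocallyFinite] (Φ : PlanarSkeletonFrm G) (t : V) (p : unitInterval) (D : Skelφ.StepI.DataNS V) (g : ℕ) (f : ℕ) (hN : EqNumL κ Φ t p D g f) (hκ : ((hL κ Φ t p D g f)).natAbs ≤ 10 * nL κ Φ t p D g f) :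
    0 ≤ (modulus (nL κ Φ t p D g f) (hL κ Φ t p D g f) (vL κ Φ t p D g f) (vβL κ Φ t p D g f)) - (shearUnit (nL κ Φ t p D g f) (hL κ Φ t p D g f) : ℤ) * ((((nL κ Φ t p D g f) : ℤ) * (ℓL κ Φ t p D g f) - (shearUnit (nL κ Φ t p D g f) (hL κ Φ t p D g f) : ℕ) + 1) / (shearUnit (nL κ Φ t p D g f) (hL κ Φ t p D g f) : ℕ)) ∧
      (modulus (nL κ Φ t p D g f) (hL κ Φ t p D g f) (vL κ Φ t p D g f) (vβL κ Φ t p D g f)) - (shearUnit (nL κ Φ t p D g f) (hL κ Φ t p D g f) : ℤ) * ((((nL κ Φ t p D g f) : ℤ) * (ℓL κ Φ t p D g f) - (shearUnit (nL κ Φ t p D g f) (hL κ Φ t p D g f) : ℕ) + 1) / (shearUnit (nL κ Φ t p D g f) (hL κ Φ t p D g f) : ℕ)) ≤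
        2 * (shearUnit (nL κ Φ t p D g f) (hL κ Φ t p D g f) : ℤ) - 2 := by
  obtain ⟨hn1, -⟩ := one_le_of_eqNumL κ Φ t p D g f hN
  obtain ⟨hU1, -⟩ := clr_shearUnit_bounds κ Φ t p D g f hκ
  obtain ⟨hmlo, hmhi⟩ := modulus_top κ Φ t p D g f hn1
  have hn1' : (1 : ℤ) ≤ (nL κ Φ t p D g f) := by exact_mod_cast hn1
  have hU : (0 : ℤ) < (shearUnit (nL κ Φ t p D g f) (hL κ Φ t p D g f) : ℤ) := by linarith
  obtain ⟨f1, f2⟩ := PlanarSkeletonNeg.NegB.RootArith.floor_sandwich (x := ((nL κ Φ t p D g f) : ℤ) * (ℓL κ Φ t p D g f) - (shearUnit (nL κ Φ t p D g f) (hL κ Φ t p D g f) : ℕ) + 1) (d := (shearUnit (nL κ Φ t p D g f) (hL κ Φ t p D g f) : ℤ)) hU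
  constructor
  · linarith
  · linarith

/-- **`u₁·U ≤ m`** (`u₁ = ⌊m/U⌋ − 1`, `U = n_L + |h_L|`). [folklore] -/
theorem u₁_mul_U_le (κ : Consts) {V : Type} [DecidableEq V] [Countable V] {G : SimpleGraph V} [G.LocallyFinite] (Φ : PlanarSkeletonFrm G) (t : V) (p : unitInterval) (D : Skelφ.StepI.DataNS V) (g : ℕ) (f : ℕ) (hN : EqNumL κ Φ t p D g f) : u₁A κ Φ t p D g f * (shearUnit (nL κ Φ t p D g f) (hL κ Φ t p D g f) : ℤ) ≤ (modulus (nL κ Φ t p D g f) (hL κ Φ t p D g f) (vL κ Φ t p D g f) (vβL κ Φ t p D g f)) ∧ 0 ≤ u₁A κ Φ t p D g f := by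
  obtain ⟨hn1, hℓ1⟩ := one_le_of_eqNumL κ Φ t p D g f hN
  have hn1' : (1 : ℤ) ≤ (nL κ Φ t p D g f) := by exact_mod_cast hn1
  have hm : 0 < (modulus (nL κ Φ t p D g f) (hL κ Φ t p D g f) (vL κ Φ t p D g f) (vβL κ Φ t p D g f)) := Skelφ.NegPrm.modulus_vβOf_pos hn1 hℓ1 _ _
  have hu : u₁A κ Φ t p D g f = fm1A κ Φ t p D g f := by unfold u₁A; exact (fcellsA_s_at κ Φ t p D g f hN).2
  have hu1 : 1 ≤ u₁A κ Φ t p D g f := (units_eqA κ Φ t p D g f).2.2.2.2.2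
  have e : fm1A κ Φ t p D g f = (modulus (nL κ Φ t p D g f) (hL κ Φ t p D g f) (vL κ Φ t p D g f) (vβL κ Φ t p D g f)) / (((nL κ Φ t p D g f) : ℤ) + |(hL κ Φ t p D g f)|) - 1 := by
    unfold fm1A; rw [(mA_eq κ Φ t p D g f).2]; rfl
  have eU : (shearUnit (nL κ Φ t p D g f) (hL κ Φ t p D g f) : ℤ) = ((nL κ Φ t p D g f) : ℤ) + |(hL κ Φ t p D g f)| := by unfold Skelφ.shearUnit; push_cast [Int.natCast_natAbs]; ring
  refine ⟨?_, by linarith⟩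
  rw [hu, e, eU]
  have ha : 0 ≤ |(hL κ Φ t p D g f)| := abs_nonneg _
  set m := (modulus (nL κ Φ t p D g f) (hL κ Φ t p D g f) (vL κ Φ t p D g f) (vβL κ Φ t p D g f))
  set L := ((nL κ Φ t p D g f) : ℤ) + |(hL κ Φ t p D g f)|
  have h1 : L * (m / L) ≤ m := Int.mul_ediv_self_le (by linarith)
  nlinarith

/-- **THE y′-RUN ADVANCES THE ORDINATE READING BY `u₁` PER REGION, UP TO `2(N_r+1) + 2`**: `|F1cA yT − F1cA yL − σ·u₁·(N_r+1)| ≤ 2(N_r+1) + 2`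
for `yT := yL + crossOffY n_L ℓ_L h_L v_L σ N_r`, `σ = ±1`. [folklore] -/
theorem F1cA_crossOffY_sub_abs_le (κ : Consts) {V : Type} [DecidableEq V] [Countable V] {G : SimpleGraph V} [G.LocallyFinite] (Φ : PlanarSkeletonFrm G) (t : V) (p : unitInterval) (D : Skelφ.StepI.DataNS V) (g : ℕ) (f : ℕ) (hN : EqNumL κ Φ t p D g f) (hκ : ((hL κ Φ t p D g f)).natAbs ≤ 10 * nL κ Φ t p D g f) (yL : Site 2) {σ : ℤ} (hσ : σ = 1 ∨ σ = -1)
    (Nr : ℕ) :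
    |F1cA κ Φ t p D g f (yL + (Skelφ.crossOffY (nL κ Φ t p D g f) (ℓL κ Φ t p D g f) (hL κ Φ t p D g f) (vL κ Φ t p D g f) σ Nr)) - F1cA κ Φ t p D g f yL - σ * u₁A κ Φ t p D g f * ((Nr : ℤ) + 1)| ≤ 2 * ((Nr : ℤ) + 1) + 2 := by
  obtain ⟨hn1, hℓ1⟩ := one_le_of_eqNumL κ Φ t p D g f hN
  have hn0 : (0 : ℤ) < (nL κ Φ t p D g f) := by exact_mod_cast hn1
  have hm : 0 < (modulus (nL κ Φ t p D g f) (hL κ Φ t p D g f) (vL κ Φ t p D g f) (vβL κ Φ t p D g f)) := Skelφ.NegPrm.modulus_vβOf_pos hn1 hℓ1 _ _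
  obtain ⟨hwU, hw0⟩ := u₁_mul_U_le κ Φ t p D g f hN
  obtain ⟨hwn, -⟩ := u₁_mul_nL_le κ Φ t p D g f hN
  obtain ⟨hε0, hε1⟩ := sLoU_bounds κ Φ t p D g f hN hκ
  obtain ⟨hU1, hU2⟩ := clr_shearUnit_bounds κ Φ t p D g f hκ
  rw [F1cA_eq, F1cA_eq]
  have hΔ := Λ₁of_crossOffY κ Φ t p D g f yL σ Nr
  have hX : (Skelφ.crossOffY (nL κ Φ t p D g f) (ℓL κ Φ t p D g f) (hL κ Φ t p D g f) (vL κ Φ t p D g f) σ Nr) 0 = σ * (((Nr : ℤ) + 1) * (vL κ Φ t p D g f)) := by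
    simp only [Skelφ.crossOffY, Skelφ.pt_zero]
  have hY : (Skelφ.crossOffY (nL κ Φ t p D g f) (ℓL κ Φ t p D g f) (hL κ Φ t p D g f) (vL κ Φ t p D g f) σ Nr) 1 = (σ * (((Nr : ℤ) + 1) * ((((nL κ Φ t p D g f) : ℤ) * (ℓL κ Φ t p D g f) - (shearUnit (nL κ Φ t p D g f) (hL κ Φ t p D g f) : ℕ) + 1) / (shearUnit (nL κ Φ t p D g f) (hL κ Φ t p D g f) : ℕ))) * (shearUnit (nL κ Φ t p D g f) (hL κ Φ t p D g f) : ℤ) +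
      (hL κ Φ t p D g f) * (σ * (((Nr : ℤ) + 1) * (vL κ Φ t p D g f)))) / ((nL κ Φ t p D g f) : ℤ) := by
    simp only [Skelφ.crossOffY, Skelφ.pt_one]
  set m := (modulus (nL κ Φ t p D g f) (hL κ Φ t p D g f) (vL κ Φ t p D g f) (vβL κ Φ t p D g f)) with hmdef
  set w := u₁A κ Φ t p D g f
  set n : ℤ := ((nL κ Φ t p D g f) : ℤ)
  set h := (hL κ Φ t p D g f)
  set v := (vL κ Φ t p D g f)
  set U : ℤ := (shearUnit (nL κ Φ t p D g f) (hL κ Φ t p D g f) : ℤ) with hUdef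
  set sLo : ℤ := ((((nL κ Φ t p D g f) : ℤ) * (ℓL κ Φ t p D g f) - (shearUnit (nL κ Φ t p D g f) (hL κ Φ t p D g f) : ℕ) + 1) / (shearUnit (nL κ Φ t p D g f) (hL κ Φ t p D g f) : ℕ))
  have hNr0 : (0 : ℤ) ≤ (Nr : ℤ) := Nat.cast_nonneg _
  set N : ℤ := (Nr : ℤ) + 1 with hNdef
  set Λ' := Λ₁of κ Φ t p D g f (yL + (Skelφ.crossOffY (nL κ Φ t p D g f) (ℓL κ Φ t p D g f) (hL κ Φ t p D g f) (vL κ Φ t p D g f) σ Nr))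
  set Λ := Λ₁of κ Φ t p D g f yL
  -- `n·Y = A − r`, `0 ≤ r < n`
  obtain ⟨q1, q2⟩ := PlanarSkeletonNeg.NegB.RootArith.floor_sandwich (x := σ * (N * sLo) * U + h * (σ * (N * v))) (d := n) hn0
  set Y := (σ * (N * sLo) * U + h * (σ * (N * v))) / n
  have hΔ' : Λ' - Λ = n * Y - h * (σ * (N * v)) := by rw [hΔ, hX, hY]
  -- `ΔΛ₁ − σ N m = −σ N ε − r` with `ε = m − U sLo`, `r = A − nY`
  have hN0 : 0 ≤ N := by rw [hNdef]; linarith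
  have hσabs : |σ| = 1 := by rcases hσ with hs | hs <;> simp [hs]
  have key : |(Λ' - Λ) - σ * N * m| ≤ N * (2 * U - 2) + n := by
    have e : (Λ' - Λ) - σ * N * m = -(σ * (N * (m - U * sLo))) - ((σ * (N * sLo) * U + h * (σ * (N * v))) - n * Y) := by
      rw [hΔ']; ring
    rw [e]
    calc |-(σ * (N * (m - U * sLo))) - ((σ * (N * sLo) * U + h * (σ * (N * v))) - n * Y)|
        ≤ |-(σ * (N * (m - U * sLo)))| + |(σ * (N * sLo) * U + h * (σ * (N * v))) - n * Y| := abs_sub _ _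
      _ ≤ N * (2 * U - 2) + n := by
          rw [abs_neg, abs_mul, hσabs, one_mul, abs_of_nonneg (mul_nonneg hN0 hε0), abs_of_nonneg (by linarith)]
          have : N * (m - U * sLo) ≤ N * (2 * U - 2) := mul_le_mul_of_nonneg_left hε1 hN0
          linarith
  -- pass to the readings: numerators differ by `2w·(ΔΛ₁)`; split off the exact multiple `σ w N · (2m)`
  have e1 : 2 * w * Λ' + m = (2 * w * Λ + m + 2 * w * ((Λ' - Λ) - σ * N * m)) + (σ * w * N) * (2 * m) := by ring
  rw [e1, Int.add_mul_ediv_right _ _ (by linarith : (2 : ℤ) * m ≠ 0)]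
  have hc : |(2 * w * Λ + m + 2 * w * ((Λ' - Λ) - σ * N * m)) - (2 * w * Λ + m)| ≤ (2 * N + 1) * (2 * m) := by
    have e2 : (2 * w * Λ + m + 2 * w * ((Λ' - Λ) - σ * N * m)) - (2 * w * Λ + m) = 2 * (w * ((Λ' - Λ) - σ * N * m)) := by ring
    rw [e2, abs_mul, abs_of_pos (by norm_num : (0:ℤ) < 2), abs_mul, abs_of_nonneg hw0]
    have h1 : w * |(Λ' - Λ) - σ * N * m| ≤ w * (N * (2 * U - 2) + n) := mul_le_mul_of_nonneg_left key hw0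
    have h2 : (2 * N) * (w * U) ≤ (2 * N) * m := mul_le_mul_of_nonneg_left hwU (by linarith)
    have h3 : w * n ≤ m := hwn
    have h4 : 0 ≤ N * w := mul_nonneg hN0 hw0
    linarith
  have := ediv_sub_ediv_abs_le (by linarith : (0:ℤ) < 2 * m) hc
  have e3 : (2 * w * Λ + m + 2 * w * ((Λ' - Λ) - σ * N * m)) / (2 * m) + σ * w * N - (2 * w * Λ + m) / (2 * m) - σ * w * ((Nr : ℤ) + 1) =
      (2 * w * Λ + m + 2 * w * ((Λ' - Λ) - σ * N * m)) / (2 * m) - (2 * w * Λ + m) / (2 * m) := by ring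
  rw [e3]
  linarith

set_option maxHeartbeats 800000 in
/-- **THE y′-RUN'S CROSS OFFSET MOVES THE ABSCISSA READING BY AT MOST `u₀`**: `|FcA yT − FcA yL| ≤ u₀` for `yT := yL + crossOffY … σ N_r`,
`σ = ±1`, as soon as `25(N_r+1) + 13 ≤ ℓ_L` and `11 ≤ u₀`. [folklore] -/
theorem FcA_crossOffY_sub_abs_le (κ : Consts) {V : Type} [DecidableEq V] [Countable V] {G : SimpleGraph V} [G.LocallyFinite] (Φ : PlanarSkeletonFrm G) (t : V) (p : unitInterval) (D : Skelφ.StepI.DataNS V) (g : ℕ) (f : ℕ) (hN : EqNumL κ Φ t p D g f) (hκ : ((hL κ Φ t p D g f)).natAbs ≤ 10 * nL κ Φ t p D g f) (yL : Site 2) {σ : ℤ} (hσ : σ = 1 ∨ σ = -1)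
    (Nr : ℕ) (hℓN : 25 * ((Nr : ℤ) + 1) + 13 ≤ ((ℓL κ Φ t p D g f) : ℤ)) (hu11 : 11 ≤ u₀A κ Φ t p D g f) :
    |FcA κ Φ t p D g f (yL + (Skelφ.crossOffY (nL κ Φ t p D g f) (ℓL κ Φ t p D g f) (hL κ Φ t p D g f) (vL κ Φ t p D g f) σ Nr)) - FcA κ Φ t p D g f yL| ≤ u₀A κ Φ t p D g f := by
  obtain ⟨hn1, hℓ1⟩ := one_le_of_eqNumL κ Φ t p D g f hN
  have hn0 : (0 : ℤ) < (nL κ Φ t p D g f) := by exact_mod_cast hn1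
  have hm : 0 < (modulus (nL κ Φ t p D g f) (hL κ Φ t p D g f) (vL κ Φ t p D g f) (vβL κ Φ t p D g f)) := Skelφ.NegPrm.modulus_vβOf_pos hn1 hℓ1 _ _
  obtain ⟨huL, hu0⟩ := u₀_mul_L0hat_le κ Φ t p D g f hN
  obtain ⟨hε0, hε1⟩ := sLoU_bounds κ Φ t p D g f hN hκ
  obtain ⟨hU1, hU2⟩ := clr_shearUnit_bounds κ Φ t p D g f hκ
  obtain ⟨hmlo, -⟩ := modulus_top κ Φ t p D g f hn1
  have hv := hN.v_le
  rw [FcA_eq, FcA_eq]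
  have hΔ := Λ₀of_crossOffY κ Φ t p D g f yL σ Nr
  have hX : (Skelφ.crossOffY (nL κ Φ t p D g f) (ℓL κ Φ t p D g f) (hL κ Φ t p D g f) (vL κ Φ t p D g f) σ Nr) 0 = σ * (((Nr : ℤ) + 1) * (vL κ Φ t p D g f)) := by
    simp only [Skelφ.crossOffY, Skelφ.pt_zero]
  have hY : (Skelφ.crossOffY (nL κ Φ t p D g f) (ℓL κ Φ t p D g f) (hL κ Φ t p D g f) (vL κ Φ t p D g f) σ Nr) 1 = (σ * (((Nr : ℤ) + 1) * ((((nL κ Φ t p D g f) : ℤ) * (ℓL κ Φ t p D g f) - (shearUnit (nL κ Φ t p D g f) (hL κ Φ t p D g f) : ℕ) + 1) / (shearUnit (nL κ Φ t p D g f) (hL κ Φ t p D g f) : ℕ))) * (shearUnit (nL κ Φ t p D g f) (hL κ Φ t p D g f) : ℤ) +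
      (hL κ Φ t p D g f) * (σ * (((Nr : ℤ) + 1) * (vL κ Φ t p D g f)))) / ((nL κ Φ t p D g f) : ℤ) := by
    simp only [Skelφ.crossOffY, Skelφ.pt_one]
  set m := (modulus (nL κ Φ t p D g f) (hL κ Φ t p D g f) (vL κ Φ t p D g f) (vβL κ Φ t p D g f)) with hmdef
  set u := u₀A κ Φ t p D g f
  set n : ℤ := ((nL κ Φ t p D g f) : ℤ)
  set h := (hL κ Φ t p D g f)
  set v := (vL κ Φ t p D g f)
  set vβ := (vβL κ Φ t p D g f)
  set U : ℤ := (shearUnit (nL κ Φ t p D g f) (hL κ Φ t p D g f) : ℤ) with hUdef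
  set sLo : ℤ := ((((nL κ Φ t p D g f) : ℤ) * (ℓL κ Φ t p D g f) - (shearUnit (nL κ Φ t p D g f) (hL κ Φ t p D g f) : ℕ) + 1) / (shearUnit (nL κ Φ t p D g f) (hL κ Φ t p D g f) : ℕ))
  have hNr0 : (0 : ℤ) ≤ (Nr : ℤ) := Nat.cast_nonneg _
  set N : ℤ := (Nr : ℤ) + 1 with hNdef
  set Λ' := Λ₀of κ Φ t p D g f (yL + (Skelφ.crossOffY (nL κ Φ t p D g f) (ℓL κ Φ t p D g f) (hL κ Φ t p D g f) (vL κ Φ t p D g f) σ Nr))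
  set Λ := Λ₀of κ Φ t p D g f yL
  obtain ⟨q1, q2⟩ := PlanarSkeletonNeg.NegB.RootArith.floor_sandwich (x := σ * (N * sLo) * U + h * (σ * (N * v))) (d := n) hn0
  set Y := (σ * (N * sLo) * U + h * (σ * (N * v))) / n
  have hΔ' : Λ' - Λ = vβ * (σ * (N * v)) - v * Y := by rw [hΔ, hX, hY]
  have hN0 : 0 ≤ N := by rw [hNdef]; linarith
  have hN1 : 1 ≤ N := by rw [hNdef]; linarith
  have hσabs : |σ| = 1 := by rcases hσ with hs | hs <;> simp [hs]
  obtain ⟨hv1, hv2⟩ := abs_le.1 hv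
  -- `n·ΔΛ₀ = σ N v ε + v r`
  have hnΔ : n * (Λ' - Λ) = σ * (N * v) * (m - U * sLo) + v * ((σ * (N * sLo) * U + h * (σ * (N * v))) - n * Y) := by
    rw [hΔ', hmdef]; unfold TwoAxis.Para.modulus; ring
  have key : n * |Λ' - Λ| ≤ n * (N * (2 * U - 2) + n) := by
    have e1 : n * |Λ' - Λ| = |n * (Λ' - Λ)| := by rw [abs_mul, abs_of_pos hn0]
    rw [e1, hnΔ]
    have hv0 : 0 ≤ |v| := abs_nonneg v
    have t1 : |σ * (N * v) * (m - U * sLo)| ≤ N * n * (2 * U - 2) := by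
      rw [abs_mul, abs_mul, hσabs, one_mul, abs_mul, abs_of_nonneg hN0, abs_of_nonneg hε0]
      calc N * |v| * (m - U * sLo) ≤ N * n * (m - U * sLo) :=
            mul_le_mul_of_nonneg_right (mul_le_mul_of_nonneg_left hv hN0) hε0
        _ ≤ N * n * (2 * U - 2) := mul_le_mul_of_nonneg_left hε1 (mul_nonneg hN0 hn0.le)
    have t2 : |v * ((σ * (N * sLo) * U + h * (σ * (N * v))) - n * Y)| ≤ n * n := by
      rw [abs_mul, abs_of_nonneg (by linarith : (0:ℤ) ≤ (σ * (N * sLo) * U + h * (σ * (N * v))) - n * Y)]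
      exact mul_le_mul hv (by linarith) (by linarith) hn0.le
    have := abs_add_le (σ * (N * v) * (m - U * sLo)) (v * ((σ * (N * sLo) * U + h * (σ * (N * v))) - n * Y))
    nlinarith
  have key' : |Λ' - Λ| ≤ N * (2 * U - 2) + n := le_of_mul_le_mul_left key hn0
  -- `u·|ΔΛ₀| ≤ (u − 1)·m`
  have hml : n * ((ℓL κ Φ t p D g f) : ℤ) - 11 * n + 1 ≤ m := by linarith
  have hbud : u * (N * (2 * U - 2) + n) ≤ (u - 1) * m := by
    have a1 : N * (2 * U - 2) ≤ N * (22 * n) := mul_le_mul_of_nonneg_left (by linarith) hN0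
    have a : N * (2 * U - 2) + n ≤ n * (22 * N + 1) := by linarith
    have b : u * (N * (2 * U - 2) + n) ≤ u * (n * (22 * N + 1)) := mul_le_mul_of_nonneg_left a hu0
    have c1 : n * (25 * N + 2) ≤ n * (((ℓL κ Φ t p D g f) : ℤ) - 11) := mul_le_mul_of_nonneg_left (by linarith) hn0.le
    have c2 : n * (25 * N + 2) ≤ m := by linarith
    have c : (u - 1) * (n * (25 * N + 2)) ≤ (u - 1) * m := mul_le_mul_of_nonneg_left c2 (by linarith)
    have d0 : 33 * N ≤ 3 * u * N := by have := mul_le_mul_of_nonneg_right hu11 hN0; linarith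
    have d1 : n * (u * (22 * N + 1)) ≤ n * ((u - 1) * (25 * N + 2)) := mul_le_mul_of_nonneg_left (by linarith) hn0.le
    linarith
  have hc : |(2 * u * Λ' + m) - (2 * u * Λ + m)| ≤ (u - 1) * (2 * m) := by
    have e2 : (2 * u * Λ' + m) - (2 * u * Λ + m) = 2 * (u * (Λ' - Λ)) := by ring
    rw [e2, abs_mul, abs_of_pos (by norm_num : (0:ℤ) < 2), abs_mul, abs_of_nonneg hu0]
    have := mul_le_mul_of_nonneg_left key' hu0
    linarith
  have := ediv_sub_ediv_abs_le (by linarith : (0:ℤ) < 2 * m) hc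
  linarith

end ShiftY

end KS

end NegB

end PlanarSkeletonFrm

end Summit.CriticalPhenomena.PercolationContinuityZ3.Theorems.Transplant

end
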